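import Summits.CriticalPhenomena.PercolationContinuityZ3.Theorems.Transplant.FKConnectivityAllQAntipodalX2SpineDefs
import HarnessLib

/-!
# Connectivity correlation inequalities for `φ_{w,q}` — the spine of a marked edge, file 2: EXTRACTION of the spine from a
# two-terminal series–parallel structure, and the bookkeeping facts along a spine

Helper file (`--supports stmt-CriticalPhenomena-4575`), FK sub-lane `prim-bschramm-fk-2` (gen 14); builds on p205010 (kernel
theorem, internal audit signed; external expert review pending).  No definitions, no named facts, no sorries; standard axioms.

* `FK.IsSpine.snoc` — gluing one more part at the OUTER end of a spine;
* `FK.exists_spine` — **(S1) of memo g13 §7.3**: if `E` is two-terminal series–parallel between `s, t` (`FK.IsTTSP E s t`) and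
  `uv ∈ E`, then the marked edge has a spine: `IsSpine ps {uv} u v E s t` or `IsSpine ps {uv} v u E s t` for some list of parts `ps`
  (structural induction on `IsTTSP`: the edge lies in one of the two parts of every composition, and the other part is glued on);
* along a spine: the inner composite and all parts are contained in the outer network and cover it (`IsSpine.subset`,
  `IsSpine.mem_cases`), the parts are edge-disjoint from the inner composite and pairwise (`IsSpine.disjoint_parts`,
  `IsSpine.pairwise_disjoint`), every part is two-terminal series–parallel between its terminals (`IsSpine.parts_isTTSP`), and
  the outer composite is two-terminal series–parallel if the inner one is (`IsSpine.isTTSP`).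
[cite: Grimmett2006, §3.9 (p. 63)]
-/

noncomputable section

namespace Summit.CriticalPhenomena.PercolationContinuityZ3.Theorems

namespace FK

open SimpleGraph Literature.Probability.LatticeModels Literature.Probability.Percolation X2Word
open scoped Classical

variable {V : Type*}

/-! ### Gluing at the outer end; extraction -/

/-- **Snoc**: a spine from `(M; a, b)` to `(E; s, t)` followed by one more gluing onto `(E; s, t)` is a spine to the new composite. [folklore] -/
theorem IsSpine.snoc {ps : List (SpinePart V)} {M E : Finset (Sym2 V)} {a b s t s' t' : V} {p : SpinePart V}
    (h : IsSpine ps M a b E s t) (hp : p.Glue E s t s' t') : IsSpine (ps ++ [p]) M a b (E ∪ p.R) s' t' := by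
  induction ps generalizing M a b with
  | nil =>
    obtain ⟨rfl, rfl, rfl⟩ := h
    exact ⟨s', t', hp, rfl, rfl, rfl⟩
  | cons p₀ ps ih =>
    obtain ⟨a', b', hg, hrest⟩ := h
    exact ⟨a', b', hg, ih hrest⟩

/-- **The spine of an edge of a two-terminal series–parallel network** ((S1) of memo g13 §7.3): if `E` is TTSP between `s, t` and
`uv ∈ E`, there is a list of parts gluing `{uv}` (with terminals `u, v` or `v, u`) up to `(E; s, t)`. [folklore] -/
theorem exists_spine {E : Finset (Sym2 V)} {s t : V} (hE : IsTTSP E s t) :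
    ∀ {u v : V}, s(u, v) ∈ E → ∃ ps : List (SpinePart V), IsSpine ps {s(u, v)} u v E s t ∨ IsSpine ps {s(u, v)} v u E s t := by
  induction hE with
  | @edge s t hst =>
    intro u v huv
    rw [Finset.mem_singleton] at huv
    refine ⟨[], ?_⟩
    rcases Sym2.eq_iff.1 huv with ⟨rfl, rfl⟩ | ⟨rfl, rfl⟩
    · exact Or.inl ⟨rfl, rfl, rfl⟩
    · exact Or.inr ⟨huv ▸ rfl, rfl, rfl⟩
  | @series E₁ E₂ a m b h₁ h₂ hd hV ha hb ih₁ ih₂ =>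
    intro u v huv
    rcases Finset.mem_union.1 huv with h | h
    · -- the edge lies in the first part: glue `E₂` in series at `m` (the right terminal)
      obtain ⟨ps, hps⟩ := ih₁ h
      have hg : SpinePart.Glue ⟨.W, E₂, m, b⟩ E₁ a m a b := SpinePart.Glue.serB h₂ hd hV ha hb
      refine ⟨ps ++ [⟨.W, E₂, m, b⟩], ?_⟩
      rcases hps with hps | hps
      · exact Or.inl (hps.snoc hg)
      · exact Or.inr (hps.snoc hg)
    · -- the edge lies in the second part: glue `E₁` in series at `m` (the left terminal)
      obtain ⟨ps, hps⟩ := ih₂ h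
      have hg : SpinePart.Glue ⟨.W, E₁, m, a⟩ E₂ m b a b :=
        SpinePart.Glue.serA h₁.symm hd.symm (fun z hz₂ hz₁ => hV z hz₁ hz₂) hb ha
      refine ⟨ps ++ [⟨.W, E₁, m, a⟩], ?_⟩
      have he : E₂ ∪ E₁ = E₁ ∪ E₂ := Finset.union_comm _ _
      rcases hps with hps | hps
      · exact Or.inl (he ▸ hps.snoc hg)
      · exact Or.inr (he ▸ hps.snoc hg)
  | @parallel E₁ E₂ s t h₁ h₂ hd hV ih₁ ih₂ =>
    intro u v huv
    rcases Finset.mem_union.1 huv with h | h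
    · obtain ⟨ps, hps⟩ := ih₁ h
      have hg : SpinePart.Glue ⟨.P, E₂, s, t⟩ E₁ s t s t := SpinePart.Glue.par h₂ hd hV
      refine ⟨ps ++ [⟨.P, E₂, s, t⟩], ?_⟩
      rcases hps with hps | hps
      · exact Or.inl (hps.snoc hg)
      · exact Or.inr (hps.snoc hg)
    · obtain ⟨ps, hps⟩ := ih₂ h
      have hg : SpinePart.Glue ⟨.P, E₁, s, t⟩ E₂ s t s t :=
        SpinePart.Glue.par h₁ hd.symm (fun z hz₂ hz₁ => hV z hz₁ hz₂)
      refine ⟨ps ++ [⟨.P, E₁, s, t⟩], ?_⟩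
      have he : E₂ ∪ E₁ = E₁ ∪ E₂ := Finset.union_comm _ _
      rcases hps with hps | hps
      · exact Or.inl (he ▸ hps.snoc hg)
      · exact Or.inr (he ▸ hps.snoc hg)

/-! ### Bookkeeping along a spine -/

/-- Gluing produces a two-terminal series–parallel network from a two-terminal series–parallel inner composite. [folklore] -/
theorem SpinePart.Glue.isTTSP_union {p : SpinePart V} {M : Finset (Sym2 V)} {a b a' b' : V} (h : p.Glue M a b a' b')
    (hM : IsTTSP M a b) : IsTTSP (M ∪ p.R) a' b' := by
  cases h with
  | par hR hd hV => exact IsTTSP.parallel hM hR hd hV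
  | serA hR hd hV hb ha' =>
    rw [Finset.union_comm]
    exact IsTTSP.series hR.symm hM hd.symm (fun z hz₁ hz₂ => hV z hz₂ hz₁) ha' hb
  | serB hR hd hV ha hb' => exact IsTTSP.series hM hR hd hV ha hb'

/-- The outer network of a spine is two-terminal series–parallel if the inner composite is. [folklore] -/
theorem IsSpine.isTTSP {ps : List (SpinePart V)} {M E : Finset (Sym2 V)} {a b s t : V} (h : IsSpine ps M a b E s t)
    (hM : IsTTSP M a b) : IsTTSP E s t := by
  induction ps generalizing M a b with
  | nil => obtain ⟨rfl, rfl, rfl⟩ := h; exact hM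
  | cons p ps ih =>
    obtain ⟨a', b', hg, hrest⟩ := h
    exact ih hrest (hg.isTTSP_union hM)

/-- The inner composite is contained in the outer network. [folklore] -/
theorem IsSpine.subset {ps : List (SpinePart V)} {M E : Finset (Sym2 V)} {a b s t : V} (h : IsSpine ps M a b E s t) :
    M ⊆ E := by
  induction ps generalizing M a b with
  | nil => obtain ⟨rfl, -, -⟩ := h; exact subset_rfl
  | cons p ps ih =>
    obtain ⟨a', b', -, hrest⟩ := h
    exact Finset.subset_union_left.trans (ih hrest)

/-- Every part is contained in the outer network. [folklore] -/
theorem IsSpine.part_subset {ps : List (SpinePart V)} {M E : Finset (Sym2 V)} {a b s t : V} (h : IsSpine ps M a b E s t) :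
    ∀ p ∈ ps, p.R ⊆ E := by
  induction ps generalizing M a b with
  | nil => intro p hp; simp at hp
  | cons p₀ ps ih =>
    obtain ⟨a', b', -, hrest⟩ := h
    intro p hp
    rcases List.mem_cons.1 hp with rfl | hp
    · exact Finset.subset_union_right.trans hrest.subset
    · exact ih hrest p hp

/-- Every edge of the outer network lies in the inner composite or in one of the parts. [folklore] -/
theorem IsSpine.mem_cases {ps : List (SpinePart V)} {M E : Finset (Sym2 V)} {a b s t : V} (h : IsSpine ps M a b E s t) :
    ∀ e ∈ E, e ∈ M ∨ ∃ p ∈ ps, e ∈ p.R := by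
  induction ps generalizing M a b with
  | nil => obtain ⟨rfl, -, -⟩ := h; exact fun e he => Or.inl he
  | cons p ps ih =>
    obtain ⟨a', b', -, hrest⟩ := h
    intro e he
    rcases ih hrest e he with h | ⟨p', hp', hep'⟩
    · rcases Finset.mem_union.1 h with h | h
      · exact Or.inl h
      · exact Or.inr ⟨p, List.mem_cons_self, h⟩
    · exact Or.inr ⟨p', List.mem_cons_of_mem _ hp', hep'⟩

/-- Every part is edge-disjoint from the inner composite. [folklore] -/
theorem IsSpine.disjoint_parts {ps : List (SpinePart V)} {M E : Finset (Sym2 V)} {a b s t : V} (h : IsSpine ps M a b E s t) :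
    ∀ p ∈ ps, Disjoint M p.R := by
  induction ps generalizing M a b with
  | nil => intro p hp; simp at hp
  | cons p₀ ps ih =>
    obtain ⟨a', b', hg, hrest⟩ := h
    intro p hp
    rcases List.mem_cons.1 hp with rfl | hp
    · exact hg.disjoint
    · exact Finset.disjoint_of_subset_left Finset.subset_union_left (ih hrest p hp)

/-- The parts of a spine are pairwise edge-disjoint. [folklore] -/
theorem IsSpine.pairwise_disjoint {ps : List (SpinePart V)} {M E : Finset (Sym2 V)} {a b s t : V} (h : IsSpine ps M a b E s t) :
    ps.Pairwise fun p p' => Disjoint p.R p'.R := by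
  induction ps generalizing M a b with
  | nil => exact List.Pairwise.nil
  | cons p ps ih =>
    obtain ⟨a', b', -, hrest⟩ := h
    refine List.Pairwise.cons (fun p' hp' => ?_) (ih hrest)
    exact Finset.disjoint_of_subset_left Finset.subset_union_right (hrest.disjoint_parts p' hp')

/-- Every part of a spine is two-terminal series–parallel between its terminals. [folklore] -/
theorem IsSpine.parts_isTTSP {ps : List (SpinePart V)} {M E : Finset (Sym2 V)} {a b s t : V} (h : IsSpine ps M a b E s t) :
    ∀ p ∈ ps, IsTTSP p.R p.x p.y := by
  induction ps generalizing M a b with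
  | nil => intro p hp; simp at hp
  | cons p₀ ps ih =>
    obtain ⟨a', b', hg, hrest⟩ := h
    intro p hp
    rcases List.mem_cons.1 hp with rfl | hp
    · exact hg.isTTSP
    · exact ih hrest p hp

/-- For the spine of a marked edge `z`, a sub-network `T ⊆ E ∖ z` is covered by the parts. [folklore] -/
theorem IsSpine.cover_erase {ps : List (SpinePart V)} {E T : Finset (Sym2 V)} {z : Sym2 V} {a b s t : V}
    (h : IsSpine ps {z} a b E s t) (hT : T ⊆ E.erase z) : ∀ e ∈ T, ∃ p ∈ ps, e ∈ p.R := by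
  intro e he
  have he' := hT he
  rcases h.mem_cases e (Finset.mem_of_mem_erase he') with h1 | h1
  · exact absurd (Finset.mem_singleton.1 h1) (Finset.ne_of_mem_erase he')
  · exact h1

end FK

end Summit.CriticalPhenomena.PercolationContinuityZ3.Theorems

end
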